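import Summits.HubbardSuperconductivity.HubbardSuperconductivity.Theorems.WeakCouplingBCSKlLindhardEnclosureCellSound

/-!
# KL-MARGIN-SCAN reader (22) «kernel-lindhard-enclosure» — RECORDS SOUNDNESS, layer 3b: monotonicity windows, inner cosine enclosures, sine hints

Records-level facts under the three CURVED-CELL rules (boundary floor `floorBdry`, majorised hyperbola `ceilBdry`, tip `ceilTip`), which
substitute the cosine of the straddling point's coordinates: (§1) what the direction test `cosDirZ u0 u1 = some dir` certifies on the real
interval `[u0/U, u1/U]` (admissible `P`): the SIGN of `sin` and the (anti/mono)tonicity of `cos`, window by window (`[0, π]`, `[−2π, −π]`,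
`[−π, 0]`, `[π, 2π]` bracketed by `piLoZ < πU < piUpZ`), and injectivity of `cos` there; (§2) the INNER enclosure `cosInnerZ`: for an ORIENTED
interval (`u0 ≤ u1`, the hypothesis the T2-2 witness of p731099 violates) `[c0, c1]/2^40 ⊆ cos '' [u0/U, u1/U]` (intermediate values); (§3)
`absLoZ/absHiZ` bound `|cos|` from an outer range, and the CHECKED hints are sound: `sinHiOK lo hi σ ⇒ |sin x| ≤ σ/10⁴`,
`sinLoOK lo hi τ ⇒ τ/10⁴ ≤ |sin x|` whenever `2^40 cos x ∈ [lo, hi]`; (§4) a positive lower |sin| bound on a closed interval makes `cos`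
injective there (Rolle).  Honest framing: elementary trigonometry about the landed kernel definitions; nothing in this file asserts a KL
margin at any `t′ ≠ 0`, `K₃`, `U₀`, the window or B1g dominance; a Kohn–Luttinger instability statement is not ODLRO and nothing here
proves superconductivity in the Hubbard model.  (p1 g26, 2026-08-29.)
-/

noncomputable section

set_option linter.dupNamespace false

namespace Summit.HubbardSuperconductivity.HubbardSuperconductivity.Theorems.KlLindhardEnclosure

open Real Set MeasureTheory Literature.MathematicalPhysics.QuantumLattice
open Summit.HubbardSuperconductivity.HubbardSuperconductivity.Theorems

/-! ## §1 The direction test `cosDirZ` -/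

/-- What `cosDirZ = some true` certifies (integer facts): the interval lies in `[0, piLoZ]` or in `[−2·piLoZ, −piUpZ]`. -/
theorem Params.cosDirZ_true (P : Params) {u0 u1 : ℤ} (h : P.cosDirZ u0 u1 = some true) :
    (0 ≤ u0 ∧ u1 ≤ P.piLoZ) ∨ (u1 ≤ -P.piUpZ ∧ -(2 * P.piLoZ) ≤ u0) := by
  unfold Params.cosDirZ at h
  split_ifs at h with h1 h2 <;> simp_all [Bool.or_eq_true, Bool.and_eq_true, decide_eq_true_eq]

/-- What `cosDirZ = some false` certifies: the interval lies in `[−piLoZ, 0]` or in `[piUpZ, 2·piLoZ]`. -/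
theorem Params.cosDirZ_false (P : Params) {u0 u1 : ℤ} (h : P.cosDirZ u0 u1 = some false) :
    (-P.piLoZ ≤ u0 ∧ u1 ≤ 0) ∨ (P.piUpZ ≤ u0 ∧ u1 ≤ 2 * P.piLoZ) := by
  unfold Params.cosDirZ at h
  split_ifs at h with h1 h2 <;> simp_all [Bool.or_eq_true, Bool.and_eq_true, decide_eq_true_eq]

/-- **`some true` ⇒ `sin ≥ 0` and `cos` antitone** on `[u0/U, u1/U]` (admissible `P`). -/
theorem Params.cosDirZ_true_sound (P : Params) (hP : P.admissible = true) {u0 u1 : ℤ} (h : P.cosDirZ u0 u1 = some true)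
    {x y : ℝ} (hx0 : (u0 : ℝ) / (P.U : ℝ) ≤ x) (hxy : x ≤ y) (hy1 : y ≤ (u1 : ℝ) / (P.U : ℝ)) :
    0 ≤ Real.sin x ∧ 0 ≤ Real.sin y ∧ Real.cos y ≤ Real.cos x := by
  have hU : 0 < P.U := P.U_pos_of_admissible hP
  have hU' : (0 : ℝ) < (P.U : ℝ) := by exact_mod_cast hU
  have hlo := P.piLoZ_lt_pi_mul hP
  have hup := P.pi_mul_lt_piUpZ hP
  have hx0' : (u0 : ℝ) ≤ x * (P.U : ℝ) := by rwa [div_le_iff₀ hU'] at hx0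
  have hy1' : y * (P.U : ℝ) ≤ (u1 : ℝ) := by rwa [le_div_iff₀ hU'] at hy1
  rcases P.cosDirZ_true h with ⟨h1, h2⟩ | ⟨h1, h2⟩
  · -- window [0, π]
    have h1' : (0 : ℝ) ≤ (u0 : ℝ) := by exact_mod_cast h1
    have h2' : (u1 : ℝ) ≤ (P.piLoZ : ℝ) := by exact_mod_cast h2
    have hx : 0 ≤ x := by nlinarith
    have hy : y ≤ π := by nlinarith
    exact ⟨Real.sin_nonneg_of_nonneg_of_le_pi hx (hxy.trans hy), Real.sin_nonneg_of_nonneg_of_le_pi (hx.trans hxy) hy,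
      Real.cos_le_cos_of_nonneg_of_le_pi hx hy hxy⟩
  · -- window [−2π, −π]: shift by 2π
    have h1' : (u1 : ℝ) ≤ -(P.piUpZ : ℝ) := by exact_mod_cast h1
    have h2' : -(2 * (P.piLoZ : ℝ)) ≤ (u0 : ℝ) := by exact_mod_cast h2
    have hx : 0 ≤ x + 2 * π := by nlinarith
    have hy : y + 2 * π ≤ π := by nlinarith
    refine ⟨?_, ?_, ?_⟩
    · rw [← Real.sin_add_two_pi]; exact Real.sin_nonneg_of_nonneg_of_le_pi hx (by linarith)
    · rw [← Real.sin_add_two_pi]; exact Real.sin_nonneg_of_nonneg_of_le_pi (by linarith) hy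
    · rw [← Real.cos_add_two_pi y, ← Real.cos_add_two_pi x]
      exact Real.cos_le_cos_of_nonneg_of_le_pi hx hy (by linarith)

/-- **`some false` ⇒ `sin ≤ 0` and `cos` monotone** on `[u0/U, u1/U]` (admissible `P`). -/
theorem Params.cosDirZ_false_sound (P : Params) (hP : P.admissible = true) {u0 u1 : ℤ} (h : P.cosDirZ u0 u1 = some false)
    {x y : ℝ} (hx0 : (u0 : ℝ) / (P.U : ℝ) ≤ x) (hxy : x ≤ y) (hy1 : y ≤ (u1 : ℝ) / (P.U : ℝ)) :
    Real.sin x ≤ 0 ∧ Real.sin y ≤ 0 ∧ Real.cos x ≤ Real.cos y := by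
  have hU : 0 < P.U := P.U_pos_of_admissible hP
  have hU' : (0 : ℝ) < (P.U : ℝ) := by exact_mod_cast hU
  have hlo := P.piLoZ_lt_pi_mul hP
  have hup := P.pi_mul_lt_piUpZ hP
  have hx0' : (u0 : ℝ) ≤ x * (P.U : ℝ) := by rwa [div_le_iff₀ hU'] at hx0
  have hy1' : y * (P.U : ℝ) ≤ (u1 : ℝ) := by rwa [le_div_iff₀ hU'] at hy1
  rcases P.cosDirZ_false h with ⟨h1, h2⟩ | ⟨h1, h2⟩
  · -- window [−π, 0]: reflect
    have h1' : -(P.piLoZ : ℝ) ≤ (u0 : ℝ) := by exact_mod_cast h1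
    have h2' : (u1 : ℝ) ≤ 0 := by exact_mod_cast h2
    have hx : -π ≤ x := by nlinarith
    have hy : y ≤ 0 := by nlinarith
    refine ⟨?_, ?_, ?_⟩
    · exact Real.sin_nonpos_of_nonpos_of_neg_pi_le (by linarith) hx
    · exact Real.sin_nonpos_of_nonpos_of_neg_pi_le hy (by linarith)
    · rw [← Real.cos_neg x, ← Real.cos_neg y]
      exact Real.cos_le_cos_of_nonneg_of_le_pi (by linarith) (by linarith) (by linarith)
  · -- window [π, 2π]: reflect about 2π
    have h1' : (P.piUpZ : ℝ) ≤ (u0 : ℝ) := by exact_mod_cast h1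
    have h2' : (u1 : ℝ) ≤ 2 * (P.piLoZ : ℝ) := by exact_mod_cast h2
    have hx : π ≤ x := by nlinarith
    have hy : y ≤ 2 * π := by nlinarith
    have ex : Real.cos x = Real.cos (2 * π - x) := by rw [← Real.cos_sub_two_pi x, ← Real.cos_neg]; ring_nf
    have ey : Real.cos y = Real.cos (2 * π - y) := by rw [← Real.cos_sub_two_pi y, ← Real.cos_neg]; ring_nf
    have sx : Real.sin x = -Real.sin (2 * π - x) := by rw [← Real.sin_sub_two_pi x, ← Real.sin_neg]; ring_nf
    have sy : Real.sin y = -Real.sin (2 * π - y) := by rw [← Real.sin_sub_two_pi y, ← Real.sin_neg]; ring_nf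
    refine ⟨?_, ?_, ?_⟩
    · rw [sx, neg_nonpos]; exact Real.sin_nonneg_of_nonneg_of_le_pi (by linarith) (by linarith)
    · rw [sy, neg_nonpos]; exact Real.sin_nonneg_of_nonneg_of_le_pi (by linarith) (by linarith)
    · rw [ex, ey]; exact Real.cos_le_cos_of_nonneg_of_le_pi (by linarith) (by linarith) (by linarith)

/-- **A certified direction makes `cos` injective on the interval.** -/
theorem Params.injOn_cos_of_cosDirZ (P : Params) (hP : P.admissible = true) {u0 u1 : ℤ} {dir : Bool}
    (h : P.cosDirZ u0 u1 = some dir) : InjOn Real.cos (Icc ((u0 : ℝ) / (P.U : ℝ)) ((u1 : ℝ) / (P.U : ℝ))) := by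
  have hU : 0 < P.U := P.U_pos_of_admissible hP
  have hU' : (0 : ℝ) < (P.U : ℝ) := by exact_mod_cast hU
  have hlo := P.piLoZ_lt_pi_mul hP
  have hup := P.pi_mul_lt_piUpZ hP
  have key : ∀ s : ℝ, (∀ x ∈ Icc ((u0 : ℝ) / (P.U : ℝ)) ((u1 : ℝ) / (P.U : ℝ)), x + s ∈ Icc 0 π) →
      (∀ x, Real.cos (x + s) = Real.cos x) → InjOn Real.cos (Icc ((u0 : ℝ) / (P.U : ℝ)) ((u1 : ℝ) / (P.U : ℝ))) := by
    intro s hs hcs x hx y hy hxy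
    have := Real.injOn_cos (hs x hx) (hs y hy) (by rw [hcs, hcs]; exact hxy)
    linarith
  have mem : ∀ x : ℝ, x ∈ Icc ((u0 : ℝ) / (P.U : ℝ)) ((u1 : ℝ) / (P.U : ℝ)) → (u0 : ℝ) ≤ x * (P.U : ℝ) ∧ x * (P.U : ℝ) ≤ (u1 : ℝ) := by
    intro x hx
    exact ⟨by have := hx.1; rwa [div_le_iff₀ hU'] at this, by have := hx.2; rwa [le_div_iff₀ hU'] at this⟩
  cases dir with
  | true =>
    rcases P.cosDirZ_true h with ⟨h1, h2⟩ | ⟨h1, h2⟩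
    · have h1' : (0 : ℝ) ≤ (u0 : ℝ) := by exact_mod_cast h1
      have h2' : (u1 : ℝ) ≤ (P.piLoZ : ℝ) := by exact_mod_cast h2
      refine key 0 (fun x hx => ?_) (fun x => by rw [add_zero])
      obtain ⟨m0, m1⟩ := mem x hx
      exact ⟨by nlinarith, by nlinarith⟩
    · have h1' : (u1 : ℝ) ≤ -(P.piUpZ : ℝ) := by exact_mod_cast h1
      have h2' : -(2 * (P.piLoZ : ℝ)) ≤ (u0 : ℝ) := by exact_mod_cast h2
      refine key (2 * π) (fun x hx => ?_) (fun x => Real.cos_add_two_pi x)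
      obtain ⟨m0, m1⟩ := mem x hx
      exact ⟨by nlinarith, by nlinarith⟩
  | false =>
    rcases P.cosDirZ_false h with ⟨h1, h2⟩ | ⟨h1, h2⟩
    · -- [−π, 0]: use cos (x + π) = −cos x, injective on the shifted window via injOn of cos on [0, π]
      have h1' : -(P.piLoZ : ℝ) ≤ (u0 : ℝ) := by exact_mod_cast h1
      have h2' : (u1 : ℝ) ≤ 0 := by exact_mod_cast h2
      intro x hx y hy hxy
      obtain ⟨mx0, mx1⟩ := mem x hx
      obtain ⟨my0, my1⟩ := mem y hy
      have hx' : -x ∈ Icc 0 π := ⟨by nlinarith, by nlinarith⟩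
      have hy' : -y ∈ Icc 0 π := ⟨by nlinarith, by nlinarith⟩
      have := Real.injOn_cos hx' hy' (by rw [Real.cos_neg, Real.cos_neg]; exact hxy)
      linarith
    · have h1' : (P.piUpZ : ℝ) ≤ (u0 : ℝ) := by exact_mod_cast h1
      have h2' : (u1 : ℝ) ≤ 2 * (P.piLoZ : ℝ) := by exact_mod_cast h2
      intro x hx y hy hxy
      obtain ⟨mx0, mx1⟩ := mem x hx
      obtain ⟨my0, my1⟩ := mem y hy
      have hx' : 2 * π - x ∈ Icc 0 π := ⟨by nlinarith, by nlinarith⟩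
      have hy' : 2 * π - y ∈ Icc 0 π := ⟨by nlinarith, by nlinarith⟩
      have ex : Real.cos (2 * π - x) = Real.cos x := by rw [← Real.cos_sub_two_pi x, ← Real.cos_neg]; ring_nf
      have ey : Real.cos (2 * π - y) = Real.cos y := by rw [← Real.cos_sub_two_pi y, ← Real.cos_neg]; ring_nf
      have := Real.injOn_cos hx' hy' (by rw [ex, ey]; exact hxy)
      linarith

/-! ## §2 The inner enclosure `cosInnerZ` (oriented intervals) -/

/-- What `cosInnerZ = some (c0, c1)` returns, by direction. -/
theorem Params.cosInnerZ_eq (P : Params) {u0 u1 l0 h0 l1 h1 c0 c1 : ℤ} (h : P.cosInnerZ u0 u1 l0 h0 l1 h1 = some (c0, c1)) :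
    (P.cosDirZ u0 u1 = some true ∧ c0 = h1 ∧ c1 = l0) ∨ (P.cosDirZ u0 u1 = some false ∧ c0 = h0 ∧ c1 = l1) := by
  unfold Params.cosInnerZ at h
  rcases hd : P.cosDirZ u0 u1 with _ | ⟨_ | _⟩ <;> simp [hd] at h
  · exact Or.inr ⟨rfl, h.1.symm, h.2.symm⟩
  · exact Or.inl ⟨rfl, h.1.symm, h.2.symm⟩

/-- **THE INNER ENCLOSURE IS SOUND on an ORIENTED interval**: with endpoint records `l0/2^40 ≤ cos(u0/U) ≤ h0/2^40`,
`l1/2^40 ≤ cos(u1/U) ≤ h1/2^40` and `u0 ≤ u1`, every `b ∈ [c0, c1]/2^40` is a value of `cos` on `[u0/U, u1/U]`. -/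
theorem Params.cosInnerZ_sound (P : Params) (hP : P.admissible = true) {u0 u1 l0 h0 l1 h1 c0 c1 : ℤ}
    (h : P.cosInnerZ u0 u1 l0 h0 l1 h1 = some (c0, c1)) (hu : u0 ≤ u1)
    (hl0 : ((l0 : ℤ) : ℝ) / 2 ^ 40 ≤ Real.cos ((u0 : ℝ) / (P.U : ℝ))) (hh0 : Real.cos ((u0 : ℝ) / (P.U : ℝ)) ≤ ((h0 : ℤ) : ℝ) / 2 ^ 40)
    (hl1 : ((l1 : ℤ) : ℝ) / 2 ^ 40 ≤ Real.cos ((u1 : ℝ) / (P.U : ℝ))) (hh1 : Real.cos ((u1 : ℝ) / (P.U : ℝ)) ≤ ((h1 : ℤ) : ℝ) / 2 ^ 40) :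
    Icc (((c0 : ℤ) : ℝ) / 2 ^ 40) (((c1 : ℤ) : ℝ) / 2 ^ 40) ⊆ Real.cos '' Icc ((u0 : ℝ) / (P.U : ℝ)) ((u1 : ℝ) / (P.U : ℝ)) := by
  have hU : 0 < P.U := P.U_pos_of_admissible hP
  have hU' : (0 : ℝ) < (P.U : ℝ) := by exact_mod_cast hU
  have hu' : (u0 : ℝ) / (P.U : ℝ) ≤ (u1 : ℝ) / (P.U : ℝ) := div_le_div_of_nonneg_right (by exact_mod_cast hu) hU'.le
  have hcont : ContinuousOn Real.cos (Icc ((u0 : ℝ) / (P.U : ℝ)) ((u1 : ℝ) / (P.U : ℝ))) := Real.continuous_cos.continuousOn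
  rcases P.cosInnerZ_eq h with ⟨_, e0, e1⟩ | ⟨_, e0, e1⟩
  · subst e0 e1
    intro b hb
    exact intermediate_value_Icc' hu' hcont ⟨by linarith [hb.1], by linarith [hb.2]⟩
  · subst e0 e1
    intro b hb
    exact intermediate_value_Icc hu' hcont ⟨by linarith [hb.1], by linarith [hb.2]⟩

/-! ## §3 `|cos|` bounds from an outer range, and the checked sine hints -/

/-- `absLoZ lo hi / 2^40 ≤ |c|` for `c ∈ [lo, hi]/2^40`, and `0 ≤ absLoZ`. -/
theorem absLoZ_le {lo hi : ℤ} {c : ℝ} (h1 : ((lo : ℤ) : ℝ) / 2 ^ 40 ≤ c) (h2 : c ≤ ((hi : ℤ) : ℝ) / 2 ^ 40) :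
    0 ≤ absLoZ lo hi ∧ ((absLoZ lo hi : ℤ) : ℝ) / 2 ^ 40 ≤ |c| := by
  unfold absLoZ
  split_ifs with h
  · simp
  · push Not at h
    constructor
    · positivity
    · rw [div_le_iff₀ (by positivity), Int.cast_min, min_le_iff, Int.cast_abs, Int.cast_abs]
      rcases le_or_gt lo 0 with hlo | hlo
      · have hhi : hi < 0 := h hlo
        have hhi' : ((hi : ℤ) : ℝ) < 0 := by exact_mod_cast hhi
        have hc : c < 0 := by
          have : ((hi : ℤ) : ℝ) / 2 ^ 40 < 0 := div_neg_of_neg_of_pos hhi' (by positivity)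
          linarith
        right
        rw [abs_of_neg hhi', abs_of_neg hc]
        rw [le_div_iff₀ (by positivity)] at h2
        linarith
      · have hlo' : (0 : ℝ) < ((lo : ℤ) : ℝ) := by exact_mod_cast hlo
        have hc : 0 < c := by
          have : (0 : ℝ) < ((lo : ℤ) : ℝ) / 2 ^ 40 := by positivity
          linarith
        left
        rw [abs_of_pos hlo', abs_of_pos hc]
        rw [div_le_iff₀ (by positivity)] at h1
        linarith

/-- `|c| ≤ absHiZ lo hi / 2^40` for `c ∈ [lo, hi]/2^40`. -/
theorem le_absHiZ {lo hi : ℤ} {c : ℝ} (h1 : ((lo : ℤ) : ℝ) / 2 ^ 40 ≤ c) (h2 : c ≤ ((hi : ℤ) : ℝ) / 2 ^ 40) :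
    |c| ≤ ((absHiZ lo hi : ℤ) : ℝ) / 2 ^ 40 := by
  unfold absHiZ
  rw [le_div_iff₀ (by positivity), Int.cast_max, Int.cast_abs, Int.cast_abs, ← abs_of_pos (by positivity : (0 : ℝ) < 2 ^ 40),
    ← abs_mul]
  rw [div_le_iff₀ (by positivity)] at h1
  rw [le_div_iff₀ (by positivity)] at h2
  exact abs_le_max_abs_abs h1 h2

/-- **UPPER SINE HINT**: `sinHiOK lo hi σ` and `2^40 cos x ∈ [lo, hi]` give `|sin x| ≤ σ/10⁴`. -/
theorem abs_sin_le_of_sinHiOK {lo hi : ℤ} {σ : ℕ} (h : sinHiOK lo hi σ = true) {x : ℝ}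
    (h1 : ((lo : ℤ) : ℝ) / 2 ^ 40 ≤ Real.cos x) (h2 : Real.cos x ≤ ((hi : ℤ) : ℝ) / 2 ^ 40) :
    |Real.sin x| ≤ (σ : ℝ) / 10 ^ 4 := by
  simp only [sinHiOK, D, decide_eq_true_eq] at h
  obtain ⟨hA0, hA⟩ := absLoZ_le h1 h2
  have h' : ((2 : ℝ) ^ 40) ^ 2 * 10 ^ 8 - ((absLoZ lo hi : ℤ) : ℝ) ^ 2 * 10 ^ 8 ≤ (σ : ℝ) ^ 2 * ((2 : ℝ) ^ 40) ^ 2 := by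
    have := (Int.cast_le (R := ℝ)).mpr h
    push_cast at this
    linarith
  have hA0' : (0 : ℝ) ≤ ((absLoZ lo hi : ℤ) : ℝ) / 2 ^ 40 := by positivity
  have hcos2 : (((absLoZ lo hi : ℤ) : ℝ) / 2 ^ 40) ^ 2 ≤ Real.cos x ^ 2 := by
    rw [← sq_abs (Real.cos x)]; exact pow_le_pow_left₀ hA0' hA 2
  have hsin2 : Real.sin x ^ 2 ≤ ((σ : ℝ) / 10 ^ 4) ^ 2 := by
    rw [Real.sin_sq]
    have e1 : (((absLoZ lo hi : ℤ) : ℝ) / 2 ^ 40) ^ 2 = ((absLoZ lo hi : ℤ) : ℝ) ^ 2 / ((2 : ℝ) ^ 40) ^ 2 := by ring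
    have e2 : ((σ : ℝ) / 10 ^ 4) ^ 2 = (σ : ℝ) ^ 2 / 10 ^ 8 := by ring
    rw [e1] at hcos2
    rw [e2]
    rw [div_le_iff₀ (by positivity)] at hcos2
    rw [le_div_iff₀ (by positivity)]
    nlinarith [hcos2, h']
  exact abs_le_of_sq_le_sq hsin2 (by positivity)

/-- **LOWER SINE HINT**: `sinLoOK lo hi τ` and `2^40 cos x ∈ [lo, hi]` give `τ/10⁴ ≤ |sin x|`. -/
theorem le_abs_sin_of_sinLoOK {lo hi : ℤ} {τ : ℕ} (h : sinLoOK lo hi τ = true) {x : ℝ}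
    (h1 : ((lo : ℤ) : ℝ) / 2 ^ 40 ≤ Real.cos x) (h2 : Real.cos x ≤ ((hi : ℤ) : ℝ) / 2 ^ 40) :
    (τ : ℝ) / 10 ^ 4 ≤ |Real.sin x| := by
  simp only [sinLoOK, D, decide_eq_true_eq] at h
  have hA := le_absHiZ h1 h2
  have h' : (τ : ℝ) ^ 2 * ((2 : ℝ) ^ 40) ^ 2 ≤ (((2 : ℝ) ^ 40) ^ 2 - ((absHiZ lo hi : ℤ) : ℝ) ^ 2) * 10 ^ 8 := by
    have := (Int.cast_le (R := ℝ)).mpr h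
    push_cast at this
    linarith
  have hcos2 : Real.cos x ^ 2 ≤ (((absHiZ lo hi : ℤ) : ℝ) / 2 ^ 40) ^ 2 := by
    rw [← sq_abs (Real.cos x)]; exact pow_le_pow_left₀ (abs_nonneg _) hA 2
  have hsin2 : ((τ : ℝ) / 10 ^ 4) ^ 2 ≤ Real.sin x ^ 2 := by
    rw [Real.sin_sq]
    have e1 : (((absHiZ lo hi : ℤ) : ℝ) / 2 ^ 40) ^ 2 = ((absHiZ lo hi : ℤ) : ℝ) ^ 2 / ((2 : ℝ) ^ 40) ^ 2 := by ring
    have e2 : ((τ : ℝ) / 10 ^ 4) ^ 2 = (τ : ℝ) ^ 2 / 10 ^ 8 := by ring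
    rw [e1, le_div_iff₀ (by positivity)] at hcos2
    rw [e2, div_le_iff₀ (by positivity)]
    nlinarith [hcos2, h']
  rw [← sq_abs (Real.sin x)] at hsin2
  exact (pow_le_pow_iff_left₀ (by positivity) (abs_nonneg _) two_ne_zero).mp hsin2

/-! ## §4 A positive lower |sin| bound makes `cos` injective (Rolle) -/

/-- If `sin` does not vanish on `[x0, x1]` then `cos` is injective there. -/
theorem injOn_cos_of_sin_ne_zero {x0 x1 : ℝ} (h : ∀ x ∈ Icc x0 x1, Real.sin x ≠ 0) : InjOn Real.cos (Icc x0 x1) := by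
  intro x hx y hy hxy
  by_contra hne
  rcases lt_or_gt_of_ne hne with hlt | hlt
  · obtain ⟨c, hc, hc0⟩ := exists_hasDerivAt_eq_zero hlt Real.continuous_cos.continuousOn hxy
      (fun z _ => Real.hasDerivAt_cos z)
    exact h c ⟨hx.1.trans hc.1.le, hc.2.le.trans hy.2⟩ (by simpa using hc0)
  · obtain ⟨c, hc, hc0⟩ := exists_hasDerivAt_eq_zero hlt Real.continuous_cos.continuousOn hxy.symm
      (fun z _ => Real.hasDerivAt_cos z)
    exact h c ⟨hy.1.trans hc.1.le, hc.2.le.trans hx.2⟩ (by simpa using hc0)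

end Summit.HubbardSuperconductivity.HubbardSuperconductivity.Theorems.KlLindhardEnclosure

end
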